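import Summits.QuantumFields.BalabanUV.Beta.EriceRemainderEnclosureHistoryAutonomyThresholdWitness

/-!
# EriceRemainderEnclosureHistoryAutonomyAntitoneWitness — (E45) THE DIRECTION OF MONOTONICITY DECIDES: an ANTITONE Markov functional with a
# zeroth moment and a floor can have a CONTINUUM of box solutions at every ratio `M·γ∕b > 3√3` — the clamp family
# `φ_y(x) = max(1∕max(x, y∕√3)² − 1, 2)` at `bγ² = 2` (γ = 1, b = 2, pin 1; non-increasing in the coupling; zeroth moment `6√3∕y³`):
# its box solutions are EXACTLY the histories `h⁽ᵗ⁾`, `1∕h⁽ᵗ⁾(m)² = t + (m−1)(3∕y² − 1)` (`m ≥ 1`), `t ∈ [3, 3∕y²]` — so `h ↦ 1∕h(1)²` is a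
# BIJECTION of the solution set onto the interval `[3, 3∕y²]` and the asymptotic discrepancies ((E44a)) fill `[0, 3∕y² − 3]`; with (E43)
# (NON-DECREASING memory of ANY size ⟹ unique) and (E38a) (`M·γ ≤ 3√3·b` ⟹ unique): for monotone memory the SIGN of the dependence decides,
# and above `3√3` the solution set can be an interval (here) as well as two points ((E38c)'s tent)

Cell `pub-balaban`, β-function sub-cell, BINDER row D4 «RemainderConst leaves for Bałaban's split» (`HOME/BINDER-OWNERS.md`; owner
lineage `b2b-balaban-beta-an4`; this file by co-owner #2 lineage `b2b-balaban-beta-d4-p2`, generation 41), β-FLOW TEAM duty (1),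
FREEZE (0) honoured (def-free module in the lineage's `EriceRemainderEnclosure*` series: the family is written as explicit lambdas, no
notation; no new leaf, no new hypothesis shape; (E38c) `…HistoryAutonomyThresholdWitness.three_le_three_div_sq` BY NAME).  Companion of (E44a) `…HistoryAutonomyAsymptoticDiscrepancy` (the solutions of one flow are
classified by the asymptotic discrepancy) and of (E43b) `…HistoryAutonomyMonotoneGeneral` (non-decreasing memory ⟹ uniqueness); the ENDs over
the antitone class are (E45b) `…HistoryAutonomyAntitoneThreshold`.

HONEST FRAMING (page 1, verbatim and binding).  *"Discharging BetaPertH makes Bałaban's UV stability UNCONDITIONAL — a real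
constructive-QFT result; it is NOT the continuum limit and NOT the Clay problem."*  THIS FILE DISCHARGES NOTHING OF THE KIND.  It is an
EXPLICIT TOY FAMILY of Markov functionals (elementary real algebra: `max`, `1∕x²`, square roots) exhibiting non-uniqueness of the flow with
memory `T4BetaFlowWellPosed.MemFlow`; nothing of Bałaban's (1.22) ∕ its limit functional is asserted — in particular NOT that it is antitone,
NOT that it sits above the threshold (which monotonicity [I]'s limit functional has in the preceding couplings is NOT PRINTED, [I] p. 298;
GAPS G-t4-U2-1∕-2).  Row D4 class UNCHANGED (critical-path width 0; instance 0∕1; D4 DISCHARGE NO DATE).  HONEST DEPENDENCY: continuum YM on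
T⁴ ⇐ BetaPertH ∧ nine spine estimates (0/9 proved); BetaPertH ⇐ (D1) ∧ (D4) ∧ CAP+tail; G-an2-4 gates asym, D1 and NE2/3/4.

THE POINT (census sense (α); the AUTONOMY row, monotone memory).  (E43b) `memFlow_unique_of_monotone_zm`: a functional NON-DECREASING in the
history with a zeroth moment of ANY size and a floor has unique box solutions.  Node U2's §8 (`T4BetaFlowWellPosed`, lag-one memory): «the
SIGN of the dependence decides, not its size» (the dip functional, non-increasing in the lag-one coupling at the fixed constant 20, has two
solutions).  THIS FILE settles the other direction for the zeroth coupling, quantitatively and with the structure of the solution set: the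
CLAMP family `φ_y(x) = max(1∕max(x, y∕√3)² − 1, 2)`, `y ∈ ]0,1[`, is NON-INCREASING in the coupling, has floor `2`, ceiling `3∕y² − 1` and
zeroth moment (Lipschitz constant) `6√3∕y³`; in the box ]0,1] from the pin `1` (so `bγ² = 2`, the extremal geometry of (E38a)'s
`cubic_absorption_27`) its box solutions are EXACTLY the one-parameter family `h⁽ᵗ⁾`, `1∕h⁽ᵗ⁾(0)² = 1`, `1∕h⁽ᵗ⁾(m)² = t + (m−1)(3∕y² − 1)`
(`m ≥ 1`), `t ∈ [3, 3∕y²]`: at scale 1 the implicit step equation `a₁ = 1 + φ_y(a₁^{−1∕2})` is an IDENTITY on the whole window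
`a₁ ∈ [3, 3∕y²]` (there `φ_y(a^{−1∕2}) = a − 1`), and from scale 2 on asymptotic freedom has pushed every solution below the level `y∕√3`
where `φ_y` is constant.  So `h ↦ 1∕h(1)²` is a BIJECTION of the solution set onto `[3, 3∕y²]` (`bijOn_solutionSet`) — a CONTINUUM of box
solutions, uncountably many — and (E44a)'s classifying numbers `lim_m (1∕h(m)² − 1∕h⁽³⁾(m)²)` fill EXACTLY `[0, 3∕y² − 3]`
(`image_lim_disc_eq_Icc`).  The ratio is `M·γ∕b = 3√3∕y³`: every value above `3√3` is reached as `y ↑ 1` ((E45b)), and at `y = 1` the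
interval degenerates to the point `t = 3` — consistent with (E38a) (`M·γ ≤ 3√3·b` ⟹ unique).  With (E38c)'s tent (two box solutions, same
`D_∞`-endpoints `{0, 3∕y² − 3}`) both extremes of (E44)'s «compact line set» occur above the threshold: two points and a full interval.

WHAT IS PROVED ([folklore] real algebra; 0 `def`, 0 sorry; the functional and the family are explicit lambdas).
 §1 `abs_inv_sq_sub_inv_sq_le` (`1∕x²` is `2∕c³`-Lipschitz on `[c,∞[`), `one_div_level_sq`, `two_div_level_cube`, `one_div_sqrt_three_div_sq`.
 §2 `two_le_clampφ` (floor 2), `clampφ_le` (ceiling `3∕y² − 1`), `clampφ_eq_two` ∕ **`clampφ_eq_inv_sq`** ∕ `clampφ_eq_top` (the three regimes),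
    **`clampφ_antitone`**, **`abs_clampφ_sub_le`** (Lipschitz `6√3∕y³`), `zerothMoment_clampφ`.
 §3 `radicand_zero` ∕ `radicand_succ`, `one_div_hT_succ_sq`, `seqBox_hT`, `inv_sqrt_mem_window`, `inv_sqrt_succ_le_level`,
    **`memFlow_hT`** (every `h⁽ᵗ⁾`, `t ∈ [3, 3∕y²]`, solves), **`eq_hT_of_memFlow`** (every box solution is some `h⁽ᵗ⁾`), `one_div_hT_one_sq`,
    **`bijOn_solutionSet`** (`Set.BijOn (fun h ↦ 1∕h 1²) {solutions} (Icc 3 (3∕y²))`), `solutionSet_infinite`, `hT_three_ne`, `tendsto_disc_hT`,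
    **`image_lim_disc_eq_Icc`**.
-/

noncomputable section
open Filter Topology Finset

namespace Summit.QuantumFields.BalabanUV.Beta.EriceRemainderEnclosureHistoryAutonomyAntitoneWitness

open Literature.MathematicalPhysics.QuantumFieldTheory.Balaban1983to89
open Literature.MathematicalPhysics.QuantumFieldTheory.Balaban1983to89.T4BetaStationary
open Literature.MathematicalPhysics.QuantumFieldTheory.Balaban1983to89.T4BetaFlowWellPosed
open Summit.QuantumFields.BalabanUV.Beta.EriceRemainderEnclosureHistoryAutonomyThreshold
open Summit.QuantumFields.BalabanUV.Beta.EriceRemainderEnclosureHistoryAutonomyThresholdWitness (three_le_three_div_sq)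

variable {y : ℝ}

/-! ## §1 Inverse squares above a positive level; the constants of the family -/

/-- `x ↦ 1∕x²` is `2∕c³`-Lipschitz on `[c, ∞[` (`c > 0`). [folklore] -/
theorem abs_inv_sq_sub_inv_sq_le {c z z' : ℝ} (hc : 0 < c) (hz : c ≤ z) (hz' : c ≤ z') :
    |1 / z ^ 2 - 1 / z' ^ 2| ≤ 2 / c ^ 3 * |z - z'| := by
  have hz0 : 0 < z := hc.trans_le hz
  have hz'0 : 0 < z' := hc.trans_le hz'
  have e : 1 / z ^ 2 - 1 / z' ^ 2 = (z' - z) * ((z' + z) / (z ^ 2 * z' ^ 2)) := by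
    field_simp
    ring
  rw [e, abs_mul, abs_of_nonneg (by positivity : 0 ≤ (z' + z) / (z ^ 2 * z' ^ 2)), abs_sub_comm, mul_comm]
  refine mul_le_mul_of_nonneg_right ?_ (abs_nonneg _)
  rw [div_le_div_iff₀ (by positivity) (by positivity)]
  have h1 : c ^ 2 ≤ z ^ 2 := pow_le_pow_left₀ hc.le hz 2
  have h1' : c ^ 2 ≤ z' ^ 2 := pow_le_pow_left₀ hc.le hz' 2
  have h2 : c * z' ≤ z' ^ 2 := by rw [sq]; exact mul_le_mul_of_nonneg_right hz' hz'0.le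
  have h2' : c * z ≤ z ^ 2 := by rw [sq]; exact mul_le_mul_of_nonneg_right hz hz0.le
  have h3 : c ^ 2 * (c * z') ≤ z ^ 2 * z' ^ 2 := mul_le_mul h1 h2 (by positivity) (by positivity)
  have h3' : c ^ 2 * (c * z) ≤ z' ^ 2 * z ^ 2 := mul_le_mul h1' h2' (by positivity) (by positivity)
  nlinarith [h3, h3']

/-- The level `c = y∕√3` has `1∕c² = 3∕y²`. [folklore] -/
theorem one_div_level_sq (y : ℝ) : 1 / (y / Real.sqrt 3) ^ 2 = 3 / y ^ 2 := by
  rw [div_pow, Real.sq_sqrt (by norm_num : (0 : ℝ) ≤ 3), one_div_div]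

/-- … and `2∕c³ = 6√3∕y³`. [folklore] -/
theorem two_div_level_cube (y : ℝ) : 2 / (y / Real.sqrt 3) ^ 3 = 6 * Real.sqrt 3 / y ^ 3 := by
  have h3 : Real.sqrt 3 ^ 3 = 3 * Real.sqrt 3 := by rw [pow_succ, Real.sq_sqrt (by norm_num : (0 : ℝ) ≤ 3)]
  rw [div_pow, h3, div_div_eq_mul_div]
  ring

/-- `√(3∕y²) = √3∕y` for `y > 0`, so `1∕√(3∕y²) = y∕√3`. [folklore] -/
theorem one_div_sqrt_three_div_sq (hy0 : 0 < y) : 1 / Real.sqrt (3 / y ^ 2) = y / Real.sqrt 3 := by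
  rw [Real.sqrt_div' _ (sq_nonneg y), Real.sqrt_sq hy0.le, one_div_div]

/-! ## §2 The clamp map `φ_y(x) = max(1∕max(x, y∕√3)² − 1, 2)`: floor, ceiling, the three regimes, antitone, zeroth moment `6√3∕y³` -/

/-- FLOOR: `2 ≤ φ_y(x)`. [folklore] -/
theorem two_le_clampφ (y x : ℝ) : 2 ≤ max (1 / (max x (y / Real.sqrt 3)) ^ 2 - 1) 2 := le_max_right _ _

/-- CEILING: `φ_y(x) ≤ 3∕y² − 1` for `0 < y ≤ 1`. [folklore] -/
theorem clampφ_le (hy0 : 0 < y) (hy1 : y ≤ 1) (x : ℝ) :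
    max (1 / (max x (y / Real.sqrt 3)) ^ 2 - 1) 2 ≤ 3 / y ^ 2 - 1 := by
  have hc : 0 < y / Real.sqrt 3 := by positivity
  have h3 : 3 ≤ 3 / y ^ 2 := by
    rw [le_div_iff₀ (by positivity)]; nlinarith [mul_pos hy0 hy0]
  refine max_le ?_ (by linarith)
  have h1 : 1 / (max x (y / Real.sqrt 3)) ^ 2 ≤ 1 / (y / Real.sqrt 3) ^ 2 :=
    one_div_le_one_div_of_le (by positivity) (pow_le_pow_left₀ hc.le (le_max_right _ _) 2)
  rw [one_div_level_sq] at h1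
  linarith

/-- REGIME 1 (large couplings): `1∕√3 ≤ x ⟹ φ_y(x) = 2`. [folklore] -/
theorem clampφ_eq_two (y : ℝ) {x : ℝ} (hx : 1 / Real.sqrt 3 ≤ x) :
    max (1 / (max x (y / Real.sqrt 3)) ^ 2 - 1) 2 = 2 := by
  have hs : 0 < 1 / Real.sqrt 3 := by positivity
  have hz : 1 / Real.sqrt 3 ≤ max x (y / Real.sqrt 3) := hx.trans (le_max_left _ _)
  have h1 : 1 / (max x (y / Real.sqrt 3)) ^ 2 ≤ 1 / (1 / Real.sqrt 3) ^ 2 :=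
    one_div_le_one_div_of_le (by positivity) (pow_le_pow_left₀ hs.le hz 2)
  rw [one_div_pow, Real.sq_sqrt (by norm_num : (0 : ℝ) ≤ 3), one_div_one_div] at h1
  exact max_eq_right (by linarith)

/-- REGIME 2 (the active window): `y∕√3 ≤ x ≤ 1∕√3 ⟹ φ_y(x) = 1∕x² − 1`. [folklore] -/
theorem clampφ_eq_inv_sq (hy0 : 0 < y) {x : ℝ} (hxl : y / Real.sqrt 3 ≤ x) (hxu : x ≤ 1 / Real.sqrt 3) :
    max (1 / (max x (y / Real.sqrt 3)) ^ 2 - 1) 2 = 1 / x ^ 2 - 1 := by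
  have hc : 0 < y / Real.sqrt 3 := by positivity
  have hx0 : 0 < x := hc.trans_le hxl
  have h1 : 1 / (1 / Real.sqrt 3) ^ 2 ≤ 1 / x ^ 2 := one_div_le_one_div_of_le (by positivity) (pow_le_pow_left₀ hx0.le hxu 2)
  rw [one_div_pow, Real.sq_sqrt (by norm_num : (0 : ℝ) ≤ 3), one_div_one_div] at h1
  rw [max_eq_left hxl]
  exact max_eq_left (by linarith)

/-- REGIME 3 (small couplings): `x ≤ y∕√3 ⟹ φ_y(x) = 3∕y² − 1` (`0 < y ≤ 1`). [folklore] -/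
theorem clampφ_eq_top (hy0 : 0 < y) (hy1 : y ≤ 1) {x : ℝ} (hx : x ≤ y / Real.sqrt 3) :
    max (1 / (max x (y / Real.sqrt 3)) ^ 2 - 1) 2 = 3 / y ^ 2 - 1 := by
  have h3 : 3 ≤ 3 / y ^ 2 := by
    rw [le_div_iff₀ (by positivity)]; nlinarith [mul_pos hy0 hy0]
  rw [max_eq_right hx, one_div_level_sq]
  exact max_eq_left (by linarith)

/-- **ANTITONE**: `φ_y` is NON-INCREASING in the coupling (`x ≤ x′ ⟹ φ_y(x′) ≤ φ_y(x)`). [folklore] -/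
theorem clampφ_antitone (hy0 : 0 < y) {x x' : ℝ} (hxx' : x ≤ x') :
    max (1 / (max x' (y / Real.sqrt 3)) ^ 2 - 1) 2 ≤ max (1 / (max x (y / Real.sqrt 3)) ^ 2 - 1) 2 := by
  have hc : 0 < y / Real.sqrt 3 := by positivity
  have hz : 0 < max x (y / Real.sqrt 3) := hc.trans_le (le_max_right _ _)
  have h1 : 1 / (max x' (y / Real.sqrt 3)) ^ 2 ≤ 1 / (max x (y / Real.sqrt 3)) ^ 2 :=
    one_div_le_one_div_of_le (by positivity) (pow_le_pow_left₀ hz.le (max_le_max hxx' le_rfl) 2)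
  exact max_le_max (by linarith) le_rfl

/-- **ZEROTH MOMENT ∕ LIPSCHITZ CONSTANT `6√3∕y³`**: `|φ_y(x) − φ_y(x′)| ≤ (6√3∕y³)·|x − x′|` for all real `x, x′` (`max · 2` is 1-Lipschitz,
`1∕z²` is `2∕c³`-Lipschitz above the level `c = y∕√3`, `max · c` is 1-Lipschitz). [folklore] -/
theorem abs_clampφ_sub_le (hy0 : 0 < y) (x x' : ℝ) :
    |max (1 / (max x (y / Real.sqrt 3)) ^ 2 - 1) 2 - max (1 / (max x' (y / Real.sqrt 3)) ^ 2 - 1) 2|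
      ≤ 6 * Real.sqrt 3 / y ^ 3 * |x - x'| := by
  have hc : 0 < y / Real.sqrt 3 := by positivity
  rw [← two_div_level_cube]
  calc |max (1 / (max x (y / Real.sqrt 3)) ^ 2 - 1) 2 - max (1 / (max x' (y / Real.sqrt 3)) ^ 2 - 1) 2|
      ≤ |(1 / (max x (y / Real.sqrt 3)) ^ 2 - 1) - (1 / (max x' (y / Real.sqrt 3)) ^ 2 - 1)| := abs_max_sub_max_le_abs _ _ _
    _ = |1 / (max x (y / Real.sqrt 3)) ^ 2 - 1 / (max x' (y / Real.sqrt 3)) ^ 2| := by ring_nf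
    _ ≤ 2 / (y / Real.sqrt 3) ^ 3 * |max x (y / Real.sqrt 3) - max x' (y / Real.sqrt 3)| :=
        abs_inv_sq_sub_inv_sq_le hc (le_max_right _ _) (le_max_right _ _)
    _ ≤ 2 / (y / Real.sqrt 3) ^ 3 * |x - x'| :=
        mul_le_mul_of_nonneg_left (abs_max_sub_max_le_abs _ _ _) (by positivity)

/-- The functional `u ↦ φ_y(u 0)` has ZEROTH MOMENT `6√3∕y³` (on all histories, a fortiori on every box). [folklore] -/
theorem zerothMoment_clampφ (hy0 : 0 < y) (u u' : ℕ → ℝ) (D : ℝ) (hD : ∀ j, |u j - u' j| ≤ D) :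
    |max (1 / (max (u 0) (y / Real.sqrt 3)) ^ 2 - 1) 2 - max (1 / (max (u' 0) (y / Real.sqrt 3)) ^ 2 - 1) 2|
      ≤ 6 * Real.sqrt 3 / y ^ 3 * D :=
  (abs_clampφ_sub_le hy0 (u 0) (u' 0)).trans (mul_le_mul_of_nonneg_left (hD 0) (by positivity))

/-! ## §3 The flow of `u ↦ φ_y(u 0)` from the pin `1` in the box ]0,1]: its box solutions are EXACTLY the family `h⁽ᵗ⁾`, `t ∈ [3, 3∕y²]` -/

/-- The radicand of `h⁽ᵗ⁾(m) = (1 + m(3∕y² − 1) + (t − 3∕y²)·min(m,1))^{−1∕2}` at scale `0` is `1` … [folklore] -/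
theorem radicand_zero (y t : ℝ) :
    1 + (((0 : ℕ) : ℝ)) * (3 / y ^ 2 - 1) + (t - 3 / y ^ 2) * min (((0 : ℕ) : ℝ)) 1 = 1 := by simp

/-- … and at scale `m+1` it is `t + m·(3∕y² − 1)`. [folklore] -/
theorem radicand_succ (y t : ℝ) (m : ℕ) :
    1 + (((m + 1 : ℕ) : ℝ)) * (3 / y ^ 2 - 1) + (t - 3 / y ^ 2) * min (((m + 1 : ℕ) : ℝ)) 1 = t + (m : ℝ) * (3 / y ^ 2 - 1) := by
  have hmin : min (((m + 1 : ℕ) : ℝ)) 1 = 1 := min_eq_right (by push_cast; linarith [(Nat.cast_nonneg m : (0 : ℝ) ≤ m)])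
  rw [hmin]; push_cast; ring

/-- The recursion variable of `h⁽ᵗ⁾` at scale `m+1` is `t + m·(3∕y² − 1)` (`t ≥ 3`, `0 < y ≤ 1`). [folklore] -/
theorem one_div_hT_succ_sq (hy0 : 0 < y) (hy1 : y ≤ 1) {t : ℝ} (ht3 : 3 ≤ t) (m : ℕ) :
    1 / (1 / Real.sqrt (1 + (((m + 1 : ℕ) : ℝ)) * (3 / y ^ 2 - 1) + (t - 3 / y ^ 2) * min (((m + 1 : ℕ) : ℝ)) 1)) ^ 2 = t + (m : ℝ) * (3 / y ^ 2 - 1) := by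
  have hκ : 0 ≤ 3 / y ^ 2 - 1 := by linarith [three_le_three_div_sq hy0 hy1]
  rw [radicand_succ]
  exact one_div_sq_one_div_sqrt (by positivity)

/-- `h⁽ᵗ⁾` is a box history in ]0,1] (`t ≥ 3`, `0 < y ≤ 1`). [folklore] -/
theorem seqBox_hT (hy0 : 0 < y) (hy1 : y ≤ 1) {t : ℝ} (ht3 : 3 ≤ t) :
    SeqBox 1 (fun m : ℕ => (1 : ℝ) / Real.sqrt (1 + (m : ℝ) * (3 / y ^ 2 - 1) + (t - 3 / y ^ 2) * min (m : ℝ) 1)) := by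
  have hκ : 0 ≤ 3 / y ^ 2 - 1 := by linarith [three_le_three_div_sq hy0 hy1]
  intro m
  beta_reduce
  cases m with
  | zero => rw [radicand_zero, Real.sqrt_one, div_one]; exact ⟨one_pos, le_rfl⟩
  | succ m =>
    rw [radicand_succ]
    have hR : 1 ≤ t + (m : ℝ) * (3 / y ^ 2 - 1) := by nlinarith [(Nat.cast_nonneg m : (0 : ℝ) ≤ m)]
    refine ⟨by positivity, ?_⟩
    rw [div_le_one (Real.sqrt_pos.2 (by linarith)), Real.le_sqrt' one_pos]
    linarith

/-- At scale `1`, `h⁽ᵗ⁾(1) = 1∕√t` sits in the ACTIVE WINDOW `[y∕√3, 1∕√3]` for `t ∈ [3, 3∕y²]`. [folklore] -/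
theorem inv_sqrt_mem_window (hy0 : 0 < y) {t : ℝ} (ht3 : 3 ≤ t) (ht : t ≤ 3 / y ^ 2) :
    y / Real.sqrt 3 ≤ 1 / Real.sqrt t ∧ 1 / Real.sqrt t ≤ 1 / Real.sqrt 3 := by
  refine ⟨?_, one_div_sqrt_anti (by norm_num) ht3⟩
  rw [← one_div_sqrt_three_div_sq hy0]
  exact one_div_sqrt_anti (by positivity) ht

/-- From scale `2` on, `h⁽ᵗ⁾(m+2) = 1∕√(t + (m+1)(3∕y² − 1)) ≤ y∕√3` lies BELOW the window (`t ≥ 3`, `0 < y ≤ 1`). [folklore] -/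
theorem inv_sqrt_succ_le_level (hy0 : 0 < y) (hy1 : y ≤ 1) {t : ℝ} (ht3 : 3 ≤ t) (m : ℕ) :
    1 / Real.sqrt (t + (((m + 1 : ℕ) : ℝ)) * (3 / y ^ 2 - 1)) ≤ y / Real.sqrt 3 := by
  have hκ : 0 ≤ 3 / y ^ 2 - 1 := by linarith [three_le_three_div_sq hy0 hy1]
  rw [← one_div_sqrt_three_div_sq hy0]
  refine one_div_sqrt_anti (by positivity) ?_
  push_cast
  nlinarith [(Nat.cast_nonneg m : (0 : ℝ) ≤ m)]

/-- **EVERY `h⁽ᵗ⁾`, `t ∈ [3, 3∕y²]`, SOLVES THE FLOW** of `u ↦ φ_y(u 0)` from the pin `1`: at scale 1 through the active window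
(`φ_y(1∕√t) = t − 1`), afterwards below it (`φ_y = 3∕y² − 1`). [folklore] -/
theorem memFlow_hT (hy0 : 0 < y) (hy1 : y ≤ 1) {t : ℝ} (ht3 : 3 ≤ t) (ht : t ≤ 3 / y ^ 2) :
    MemFlow (fun u : ℕ → ℝ => max (1 / (max (u 0) (y / Real.sqrt 3)) ^ 2 - 1) 2) 1
      (fun m : ℕ => (1 : ℝ) / Real.sqrt (1 + (m : ℝ) * (3 / y ^ 2 - 1) + (t - 3 / y ^ 2) * min (m : ℝ) 1)) := by
  have h0 : (1 : ℝ) / Real.sqrt (1 + (((0 : ℕ) : ℝ)) * (3 / y ^ 2 - 1) + (t - 3 / y ^ 2) * min (((0 : ℕ) : ℝ)) 1) = 1 := by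
    rw [radicand_zero, Real.sqrt_one, div_one]
  refine ⟨h0, fun m => ?_⟩
  beta_reduce
  simp only [add_zero]
  cases m with
  | zero =>
    rw [h0, one_div_hT_succ_sq hy0 hy1 ht3 0, radicand_succ, Nat.cast_zero, zero_mul, add_zero, one_pow, div_one]
    obtain ⟨hl, hu⟩ := inv_sqrt_mem_window hy0 ht3 ht
    rw [clampφ_eq_inv_sq hy0 hl hu, one_div_sq_one_div_sqrt (by linarith)]
    ring
  | succ m =>
    rw [one_div_hT_succ_sq hy0 hy1 ht3 (m + 1), one_div_hT_succ_sq hy0 hy1 ht3 m, radicand_succ y t (m + 1),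
      clampφ_eq_top hy0 hy1 (inv_sqrt_succ_le_level hy0 hy1 ht3 m)]
    push_cast; ring

/-- **CONVERSELY, EVERY BOX SOLUTION IS SOME `h⁽ᵗ⁾`**: a box solution `h` of the flow of `u ↦ φ_y(u 0)` from the pin `1` (`0 < y ≤ 1`) has
`t := 1∕h(1)² ∈ [3, 3∕y²]` and `h = h⁽ᵗ⁾`.  (At a scale `m+1 ≥ 2` the coupling cannot exceed the level `y∕√3`: otherwise
`φ_y(h_{m+1}) ≥ 1∕h_{m+1}² − 1` and the flow equation would force `1∕h_m² ≤ 1 < 3`.) [folklore] -/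
theorem eq_hT_of_memFlow (hy0 : 0 < y) (hy1 : y ≤ 1) {h : ℕ → ℝ} (hh : SeqBox 1 h)
    (hf : MemFlow (fun u : ℕ → ℝ => max (1 / (max (u 0) (y / Real.sqrt 3)) ^ 2 - 1) 2) 1 h) :
    3 ≤ 1 / h 1 ^ 2 ∧ 1 / h 1 ^ 2 ≤ 3 / y ^ 2 ∧
      h = (fun m : ℕ => (1 : ℝ) / Real.sqrt (1 + (m : ℝ) * (3 / y ^ 2 - 1) + (1 / h 1 ^ 2 - 3 / y ^ 2) * min (m : ℝ) 1)) := by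
  have hstep : ∀ m, 1 / h (m + 1) ^ 2 = 1 / h m ^ 2 + max (1 / (max (h (m + 1)) (y / Real.sqrt 3)) ^ 2 - 1) 2 := fun m => by
    have := hf.2 m; simp only [add_zero] at this; exact this
  have h0 : 1 / h 0 ^ 2 = 1 := by rw [hf.1]; norm_num
  -- scale 1
  have ha1l : 3 ≤ 1 / h 1 ^ 2 := by
    rw [hstep 0, h0]; linarith [two_le_clampφ y (h (0 + 1))]
  have ha1u : 1 / h 1 ^ 2 ≤ 3 / y ^ 2 := by
    rw [hstep 0, h0]; linarith [clampφ_le hy0 hy1 (h (0 + 1))]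
  -- the recursion variables stay `≥ 3` from scale 1 on
  have hge3 : ∀ m, 1 ≤ m → 3 ≤ 1 / h m ^ 2 := by
    intro m hm
    induction m, hm using Nat.le_induction with
    | base => exact ha1l
    | succ m _ ih => rw [hstep m]; linarith [two_le_clampφ y (h (m + 1))]
  -- from scale 2 on the coupling is below the level, so the increment is `3∕y² − 1`
  have hkey : ∀ m, 1 ≤ m → 1 / h (m + 1) ^ 2 = 1 / h m ^ 2 + (3 / y ^ 2 - 1) := by
    intro m hm
    have hle : h (m + 1) ≤ y / Real.sqrt 3 := by
      refine le_of_not_gt fun hlt => ?_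
      have hmax : max (h (m + 1)) (y / Real.sqrt 3) = h (m + 1) := max_eq_left hlt.le
      have h1 : 1 / h (m + 1) ^ 2 - 1 ≤ max (1 / (max (h (m + 1)) (y / Real.sqrt 3)) ^ 2 - 1) 2 := by
        rw [hmax]; exact le_max_left _ _
      linarith [hstep m, hge3 m hm]
    rw [hstep m, clampφ_eq_top hy0 hy1 hle]
  have hform : ∀ m : ℕ, 1 / h (m + 1) ^ 2 = 1 / h 1 ^ 2 + (m : ℝ) * (3 / y ^ 2 - 1) := by
    intro m
    induction m with
    | zero => simp
    | succ m ih => rw [hkey (m + 1) (by omega), ih]; push_cast; ring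
  refine ⟨ha1l, ha1u, funext fun m => ?_⟩
  cases m with
  | zero => rw [radicand_zero, Real.sqrt_one, div_one]; exact hf.1
  | succ m =>
    rw [radicand_succ, ← hform m]
    exact (one_div_sqrt_one_div_sq (hh (m + 1)).1).symm

/-- `1∕h⁽ᵗ⁾(1)² = t`: the parameter IS the recursion variable at scale 1. [folklore] -/
theorem one_div_hT_one_sq (hy0 : 0 < y) (hy1 : y ≤ 1) {t : ℝ} (ht3 : 3 ≤ t) :
    1 / ((fun m : ℕ => (1 : ℝ) / Real.sqrt (1 + (m : ℝ) * (3 / y ^ 2 - 1) + (t - 3 / y ^ 2) * min (m : ℝ) 1)) 1) ^ 2 = t := by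
  have := one_div_hT_succ_sq hy0 hy1 ht3 0
  rwa [Nat.cast_zero, zero_mul, add_zero] at this

/-- **THE SOLUTION SET IS AN INTERVAL**: `h ↦ 1∕h(1)²` maps the set of box solutions of the flow of `u ↦ φ_y(u 0)` from the pin `1`
BIJECTIVELY onto `[3, 3∕y²]` (`0 < y ≤ 1`; a nondegenerate interval iff `y < 1`). [folklore] -/
theorem bijOn_solutionSet (hy0 : 0 < y) (hy1 : y ≤ 1) :
    Set.BijOn (fun h : ℕ → ℝ => 1 / h 1 ^ 2)
      {h | SeqBox 1 h ∧ MemFlow (fun u : ℕ → ℝ => max (1 / (max (u 0) (y / Real.sqrt 3)) ^ 2 - 1) 2) 1 h}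
      (Set.Icc 3 (3 / y ^ 2)) := by
  refine ⟨fun h hh => ?_, fun h hh h' hh' heq => ?_, fun t ht => ?_⟩
  · obtain ⟨hl, hu, -⟩ := eq_hT_of_memFlow hy0 hy1 hh.1 hh.2
    exact ⟨hl, hu⟩
  · obtain ⟨-, -, e⟩ := eq_hT_of_memFlow hy0 hy1 hh.1 hh.2
    obtain ⟨-, -, e'⟩ := eq_hT_of_memFlow hy0 hy1 hh'.1 hh'.2
    have heq' : 1 / h 1 ^ 2 = 1 / h' 1 ^ 2 := heq
    rw [e, e', heq']
  · exact ⟨_, ⟨seqBox_hT hy0 hy1 ht.1, memFlow_hT hy0 hy1 ht.1 ht.2⟩, one_div_hT_one_sq hy0 hy1 ht.1⟩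

/-- **INFINITELY MANY BOX SOLUTIONS** from one pin for `0 < y < 1` (the bijective image `[3, 3∕y²]` is a nondegenerate real interval). [folklore] -/
theorem solutionSet_infinite (hy0 : 0 < y) (hy1 : y < 1) :
    {h : ℕ → ℝ | SeqBox 1 h ∧ MemFlow (fun u : ℕ → ℝ => max (1 / (max (u 0) (y / Real.sqrt 3)) ^ 2 - 1) 2) 1 h}.Infinite := by
  have h3 : (3 : ℝ) < 3 / y ^ 2 := by
    rw [lt_div_iff₀ (by positivity)]; nlinarith [mul_pos hy0 hy0]
  intro hfin
  have := hfin.image (fun h : ℕ → ℝ => 1 / h 1 ^ 2)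
  rw [(bijOn_solutionSet hy0 hy1.le).image_eq] at this
  exact Set.Icc_infinite h3 this

/-- TWO NAMED MEMBERS: `h⁽³⁾ ≠ h⁽³∕ʸ²⁾` when `y < 1` (they differ at scale 1: `1∕√3` vs `y∕√3`). [folklore] -/
theorem hT_three_ne (hy0 : 0 < y) (hy1 : y < 1) :
    (fun m : ℕ => (1 : ℝ) / Real.sqrt (1 + (m : ℝ) * (3 / y ^ 2 - 1) + (3 - 3 / y ^ 2) * min (m : ℝ) 1))
      ≠ (fun m : ℕ => (1 : ℝ) / Real.sqrt (1 + (m : ℝ) * (3 / y ^ 2 - 1) + (3 / y ^ 2 - 3 / y ^ 2) * min (m : ℝ) 1)) := by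
  intro e
  have h3 : (3 : ℝ) < 3 / y ^ 2 := by
    rw [lt_div_iff₀ (by positivity)]; nlinarith [mul_pos hy0 hy0]
  have e2 : (3 : ℝ) = 3 / y ^ 2 :=
    ((one_div_hT_one_sq hy0 hy1.le le_rfl).symm.trans (congrArg (fun f : ℕ → ℝ => 1 / f 1 ^ 2) e)).trans
      (one_div_hT_one_sq hy0 hy1.le h3.le)
  exact h3.ne e2

/-- THE ASYMPTOTIC DISCREPANCIES ((E44a)) of the family: `1∕h⁽ᵗ⁾(m)² − 1∕h⁽ᵗ′⁾(m)² = t − t′` from scale 1 on, hence `→ t − t′`. [folklore] -/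
theorem tendsto_disc_hT (hy0 : 0 < y) (hy1 : y ≤ 1) {t t' : ℝ} (ht3 : 3 ≤ t) (ht'3 : 3 ≤ t') :
    Tendsto (fun m => 1 / (fun m : ℕ => (1 : ℝ) / Real.sqrt (1 + (m : ℝ) * (3 / y ^ 2 - 1) + (t - 3 / y ^ 2) * min (m : ℝ) 1)) m ^ 2
      - 1 / (fun m : ℕ => (1 : ℝ) / Real.sqrt (1 + (m : ℝ) * (3 / y ^ 2 - 1) + (t' - 3 / y ^ 2) * min (m : ℝ) 1)) m ^ 2)
      atTop (𝓝 (t - t')) := by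
  refine tendsto_const_nhds.congr' (eventually_atTop.2 ⟨1, fun m hm => ?_⟩)
  obtain ⟨k, rfl⟩ := Nat.exists_eq_add_of_le' hm
  beta_reduce
  rw [one_div_hT_succ_sq hy0 hy1 ht3 k, one_div_hT_succ_sq hy0 hy1 ht'3 k]
  ring

/-- **THE CLASSIFYING NUMBERS FILL AN INTERVAL**: against the reference solution `h⁽³⁾`, the asymptotic discrepancy `lim_m (1∕h(m)² − 1∕h⁽³⁾(m)²)`
of (E44a) ranges over EXACTLY `[0, 3∕y² − 3]` as `h` runs through the box solutions. [folklore] -/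
theorem image_lim_disc_eq_Icc (hy0 : 0 < y) (hy1 : y ≤ 1) :
    (fun h : ℕ → ℝ => limUnder atTop (fun m => 1 / h m ^ 2
        - 1 / (fun m : ℕ => (1 : ℝ) / Real.sqrt (1 + (m : ℝ) * (3 / y ^ 2 - 1) + (3 - 3 / y ^ 2) * min (m : ℝ) 1)) m ^ 2)) ''
      {h | SeqBox 1 h ∧ MemFlow (fun u : ℕ → ℝ => max (1 / (max (u 0) (y / Real.sqrt 3)) ^ 2 - 1) 2) 1 h}
      = Set.Icc 0 (3 / y ^ 2 - 3) := by
  ext d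
  simp only [Set.mem_image, Set.mem_setOf_eq, Set.mem_Icc]
  constructor
  · rintro ⟨h, ⟨hh, hf⟩, rfl⟩
    obtain ⟨hl, hu, e⟩ := eq_hT_of_memFlow hy0 hy1 hh hf
    rw [e, (tendsto_disc_hT hy0 hy1 hl le_rfl).limUnder_eq]
    exact ⟨by linarith, by linarith⟩
  · rintro ⟨hd0, hd1⟩
    refine ⟨_, ⟨seqBox_hT hy0 hy1 (t := d + 3) (by linarith), memFlow_hT hy0 hy1 (by linarith) (by linarith)⟩, ?_⟩
    rw [(tendsto_disc_hT hy0 hy1 (by linarith) le_rfl).limUnder_eq]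
    ring

end Summit.QuantumFields.BalabanUV.Beta.EriceRemainderEnclosureHistoryAutonomyAntitoneWitness

end
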